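import Literature.NumberTheory.EllipticCurves.PAdicOneVariableRelNormCoherentUnitsOfGlobal
import Literature.NumberTheory.EllipticCurves.PAdicTwoVariableColemanImageCocycleOfUnits
import Literature.NumberTheory.NumberFields.RayClassFieldLocalTowerNormUnramified
import Literature.NumberTheory.GaloisRepresentations.LubinTateRelNormCoherentUnitsPrincipalPart
import HarnessLib

/-!
# TWO-VARIABLE families of GLOBAL units as baseNorm-coherent (and principal) families of the local towers `E_i·K_π^{k+1}`:
# `x_{i,k} ∈ K(𝔪_i v^{k+1})`, norm-coherent in `k` AND in `i`, give `β = (ι x_{i,k})_{i,k} ∈ coherentFamilies`, `⟨β⟩ ∈ principalCoherentFamilies`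
# (de Shalit II.4.14 Step 1 / III.1.1–1.3 at one prime above `𝔭`: `β(𝔞) = (e(𝔞)_{𝔓, m, k}) ∈ U_∞ = lim← U_{m,k}`)

Topic `NumberTheory/EllipticCurves`; namespace `Literature.NumberTheory.EllipticCurves`.  Sequel of
`PAdicOneVariableRelNormCoherentUnitsOfGlobal` (`RelNormCoherentUnits.ofGlobal`: ONE modulus `𝔪`, the `v`-direction `K(𝔪v^{k+1})`).
De Shalit's two-variable tower `K(𝔤𝔭̄^{m+1}𝔭^{k+1})` (II.4.14, III.1.1) grows in a second, UNRAMIFIED-at-`𝔓` direction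
`𝔪_i := 𝔤𝔭̄^{i+1} ⊇ 𝔪_{i+1}`; completed at `𝔓 ∣ 𝔭` its layers are `E_i·K_π^{k+1}` with `E_i` unramified (the tree's two-variable Coleman
frame `coherentFamilies hπ E hmono` / `principalCoherentFamilies` of `LubinTateColemanUnitsImageEquivTwo`, `PAdicTwoVariableColemanImageCocycleOfUnits`).
THIS file builds the two-variable analogue of `ofGlobal`:

* §1 ★ `RelNormCoherentUnits.ofGlobal₂` — for an antitone sequence of moduli `𝔪_i` (`v ∤ 𝔪_i`, `w_{𝔪_i} = 1`, `α_i = π^{f_i} ≡ 1 mod 𝔪_i`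
  — ONE uniformiser `π` for all `i`), a monotone unramified tower `E_i` with `f_i ∣ deg w` on `Γ_{E_i}`, INERT steps
  (`E_{i+1} ⊆ K_v·ι(K(𝔪_{i+1}))`, Galois form) with the degree count, and global units `x_{i,k} ∈ K(𝔪_i v^{k+1})` norm-coherent in `k` and in
  `i`: the family `i ↦ ofGlobal (x_{i,·}) ∈ 𝒰(E_i·K_π^∞)`; ★★ `ofGlobal₂_baseNormCoherent` — **it is baseNorm-coherent**
  (`RayClassFieldLocalTowerNormUnramified`: global norms are local norms in the unramified direction); `ofGlobal₂_mem_coherentFamilies`;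
  `coe_val_ofGlobal₂`, `coe_val_galAct_ofGlobal₂` (`(σ̃·β)_{i,k} = ι((res σ̃)·x_{i,k})` — the local Galois action IS the global one);
* §2 ★ `principalPart_ofGlobal₂_mem_principalCoherentFamilies` — **`⟨β⟩ ∈ principalCoherentFamilies`** (principal projection,
  `LubinTateRelNormCoherentUnitsPrincipalPart`): the two-variable elliptic units enter the domain `𝒰¹_∞` of the two-variable Coleman map;
* §3 `extendDown` — re-indexing a coherent family given on the shifted tower `E_{i+c}` (the global level `i` sits at the local unramified level
  `i + c` when `[K(𝔪_0)_𝔓 : K_v] = [E_c : K_v]`) to a coherent family on the whole tower `E_j` (norms down to `E_j`, `j < c`):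
  ★ `extendDown_mem_coherentFamilies`, `extendDown_add`, `extendDown_mem_principalCoherentFamilies`.

Definitions `RelNormCoherentUnits.ofGlobal₂`, `extendDown`; theorems otherwise; no named facts, no instances, no `sorry`.

## References
* [deShalit1987] E. de Shalit, *Iwasawa theory of elliptic curves with complex multiplication* (1987), II.4.5 (12) (p. 58), II.4.14 Step 1
  (p. 71), III.1.1–1.3 (p. 88–90, 101).
* [SerreLocalFields1979] J.-P. Serre, *Local Fields* (1979), Ch. II §2 Prop. 3, §4 Prop. 8.
-/

noncomputable section

namespace Literature.NumberTheory.EllipticCurves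

open NumberField IsDedekindDomain IsDedekindDomain.HeightOneSpectrum Field ValuativeRel IsLocalRing
open Literature.NumberTheory.GaloisRepresentations Literature.NumberTheory.GaloisRepresentations.IsNonarchimedeanLocalField
  Literature.NumberTheory.GaloisRepresentations.LubinTate Literature.NumberTheory.NumberFields

attribute [local instance] ltNormUniformSpace ltNormIsUniformAddGroup rk1 nF nE fintypeResidueField

/-! ### §1. `ofGlobal₂`: doubly norm-coherent global units as a baseNorm-coherent family -/

section OfGlobal₂

variable {K : Type} [Field K] [NumberField K] [IsTotallyComplex K] {v : HeightOneSpectrum (𝓞 K)}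
  {π : 𝒪[v.adicCompletion K]} (hπ : (valuation (v.adicCompletion K)).IsUniformizer (π : v.adicCompletion K))
  -- the moduli `𝔪_i` (antitone), `v ∤ 𝔪_i`, `w_{𝔪_i} = 1`, and `α_i = π^{f_i} ≡ 1 mod 𝔪_i`
  {𝔪 : ℕ → Ideal (𝓞 K)} (h𝔪0 : ∀ i, 𝔪 i ≠ ⊥) (hanti : ∀ i, 𝔪 (i + 1) ≤ 𝔪 i) (hv : ∀ i, ¬ 𝔪 i ≤ v.asIdeal)
  (hw : ∀ i, ∀ u : (𝓞 K)ˣ, (u : 𝓞 K) - 1 ∈ 𝔪 i → u = 1)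
  {α : ℕ → 𝓞 K} (hα0 : ∀ i, α i ≠ 0) (hα𝔪 : ∀ i, α i - 1 ∈ 𝔪 i) (hαw : ∀ i, ∀ w : HeightOneSpectrum (𝓞 K), w ≠ v → α i ∉ w.asIdeal)
  {f : ℕ → ℕ} (hαπ : ∀ i, ((α i : K) : v.adicCompletion K) = (π : v.adicCompletion K) ^ f i)
  -- the local unramified tower `E_i`
  (E : ℕ → IntermediateField (v.adicCompletion K) (AlgebraicClosure (v.adicCompletion K)))
  [∀ i, FiniteDimensional (v.adicCompletion K) (E i)] [∀ i, IsGalois (v.adicCompletion K) (E i)]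
  (hmono : Monotone E) (hE : ∀ i, E i ≤ maxUnramified (v.adicCompletion K))
  (hdegE : ∀ i, ∀ w : WeilGroup (v.adicCompletion K),
    WeilGroup.toAbsGalois (v.adicCompletion K) w ∈ (E i).fixingSubgroup → (f i : ℤ) ∣ WeilGroup.deg w)
  -- the global units
  (x : ∀ i k : ℕ, rayClassField K (𝔪 i * v.asIdeal ^ (k + 1)))
  (hx0 : ∀ i k : ℕ, ((x i k : rayClassField K (𝔪 i * v.asIdeal ^ (k + 1))) : AlgebraicClosure K) ≠ 0)
  (hint : ∀ i k : ℕ, IsIntegral ℤ ((x i k : rayClassField K (𝔪 i * v.asIdeal ^ (k + 1))) : AlgebraicClosure K))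
  (hint' : ∀ i k : ℕ, IsIntegral ℤ ((x i k : rayClassField K (𝔪 i * v.asIdeal ^ (k + 1))) : AlgebraicClosure K)⁻¹)
  (hcoh : ∀ i, ∀ n k (hnk : n ≤ k),
    ((@Algebra.norm (rayClassField K (𝔪 i * v.asIdeal ^ (n + 1))) (rayClassField K (𝔪 i * v.asIdeal ^ (k + 1))) _ _
        (towerAlgebra (rayClassField_mul_pow_succ_mono (h𝔪0 i) v hnk)) (x i k) :
      rayClassField K (𝔪 i * v.asIdeal ^ (n + 1))) : AlgebraicClosure K) = x i n)

/-- ★ **`ofGlobal₂ x = (ι x_{i,k})_{i,k}`**: the two-variable family of local norm-coherent units attached to global units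
`x_{i,k} ∈ K(𝔪_i v^{k+1})` — at each unramified level `i`, the one-variable `RelNormCoherentUnits.ofGlobal` for the modulus `𝔪_i` and the
base `E_i`. (de Shalit: `β(𝔞) = (e(𝔞)_{𝔓})` in `U_∞ = lim← U_{m,k}`, one `𝔓`-component.) [cite: deShalit1987, II.4.5 (12) (p. 58), III.1.1 (p. 88)] -/
def _root_.Literature.NumberTheory.GaloisRepresentations.RelNormCoherentUnits.ofGlobal₂ (i : ℕ) : RelNormCoherentUnits hπ (E i) :=
  RelNormCoherentUnits.ofGlobal (h𝔪0 i) (hv i) (hw i) hπ (hα0 i) (hα𝔪 i) (hαw i) (hαπ i) (E i) (hE i) (hdegE i) (x i) (hx0 i)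
    (hint i) (hint' i) (hcoh i)

/-- Components: `(ofGlobal₂ x)_{i,k} = ι(x_{i,k})`. [cite: deShalit1987, II.4.5 (12) (p. 58)] -/
theorem coe_val_ofGlobal₂ (i k : ℕ) :
    ((((RelNormCoherentUnits.ofGlobal₂ hπ h𝔪0 hv hw hα0 hα𝔪 hαw hαπ E hE hdegE x hx0 hint hint' hcoh i).val k :
        unitBall (E i ⊔ ltField π k : IntermediateField (v.adicCompletion K) (AlgebraicClosure (v.adicCompletion K)))) :
        (E i ⊔ ltField π k : IntermediateField (v.adicCompletion K) (AlgebraicClosure (v.adicCompletion K)))) :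
      AlgebraicClosure (v.adicCompletion K)) =
      absClosureEmbedding K (v.adicCompletion K) (x i k) := rfl

/-- **The local Galois action is the global one**: `(σ̃ · ofGlobal₂ x)_{i,k} = ι((res σ̃) • x_{i,k})` for every `σ̃ ∈ Γ_{K_v}`
(`ι ∘ res σ̃ = σ̃ ∘ ι`). [cite: deShalit1987, II.4.5 (13) (p. 58), III.1.2 (p. 101)] -/
theorem coe_val_galAct_ofGlobal₂ (σ : absoluteGaloisGroup (v.adicCompletion K)) (i k : ℕ) :
    (((((RelNormCoherentUnits.ofGlobal₂ hπ h𝔪0 hv hw hα0 hα𝔪 hαw hαπ E hE hdegE x hx0 hint hint' hcoh i).galAct σ).val k :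
        unitBall (E i ⊔ ltField π k : IntermediateField (v.adicCompletion K) (AlgebraicClosure (v.adicCompletion K)))) :
        (E i ⊔ ltField π k : IntermediateField (v.adicCompletion K) (AlgebraicClosure (v.adicCompletion K)))) :
      AlgebraicClosure (v.adicCompletion K)) =
      absClosureEmbedding K (v.adicCompletion K)
        (absGaloisRestrict K (v.adicCompletion K) σ • ((x i k : rayClassField K (𝔪 i * v.asIdeal ^ (k + 1))) : AlgebraicClosure K)) := by
  rw [RelNormCoherentUnits.coe_val_galAct, coe_relRestrict_apply, absGaloisRestrict_apply_smul]
  rfl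

variable
  -- INERT steps (Galois form) and the degree count
  (hinert : ∀ i, ∀ τ : absoluteGaloisGroup (v.adicCompletion K),
    (∀ y ∈ rayClassField K (𝔪 (i + 1)),
      τ • absClosureEmbedding K (v.adicCompletion K) y = absClosureEmbedding K (v.adicCompletion K) y) →
      τ ∈ (E (i + 1)).fixingSubgroup)
  (hcount : ∀ i k : ℕ, IntermediateField.relfinrank (rayClassField K (𝔪 i * v.asIdeal ^ (k + 1)))
      (rayClassField K (𝔪 (i + 1) * v.asIdeal ^ (k + 1))) * Module.finrank (v.adicCompletion K) (E i) ≤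
      Module.finrank (v.adicCompletion K) (E (i + 1)))
  -- norm-coherence in the unramified direction
  (hcoh₂ : ∀ i k : ℕ, ((@Algebra.norm (rayClassField K (𝔪 i * v.asIdeal ^ (k + 1))) (rayClassField K (𝔪 (i + 1) * v.asIdeal ^ (k + 1))) _ _
      (towerAlgebra (rayClassField_le_of_le (mul_ne_zero (h𝔪0 (i + 1)) (pow_ne_zero _ v.ne_bot)) (Ideal.mul_mono_left (hanti i))))
      (x (i + 1) k) : rayClassField K (𝔪 i * v.asIdeal ^ (k + 1))) : AlgebraicClosure K) = x i k)

include hanti hinert hcount hcoh₂ in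
/-- ★★ **`ofGlobal₂ x` IS baseNorm-COHERENT**: `N_{E_{i+1}K_π^{k+1}/E_iK_π^{k+1}} ι(x_{i+1,k}) = ι(N_{K(𝔪_{i+1}v^{k+1})/K(𝔪_iv^{k+1})} x_{i+1,k})
= ι(x_{i,k})` — global norms are local norms in the unramified direction (`RayClassFieldLocalTowerNormUnramified`, inert step + count).
[cite: deShalit1987, II.4.14 Step 1 (p. 71), III.1.1–1.2 (2) (p. 88–89, 101)] -/
theorem ofGlobal₂_baseNormCoherent (i : ℕ) :
    (RelNormCoherentUnits.ofGlobal₂ hπ h𝔪0 hv hw hα0 hα𝔪 hαw hαπ E hE hdegE x hx0 hint hint' hcoh (i + 1)).baseNorm hπ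
        (hmono (Nat.le_succ i)) =
      RelNormCoherentUnits.ofGlobal₂ hπ h𝔪0 hv hw hα0 hα𝔪 hαw hαπ E hE hdegE x hx0 hint hint' hcoh i := by
  refine RelNormCoherentUnits.ext fun k => Subtype.ext (Subtype.ext ?_)
  rw [RelNormCoherentUnits.coe_val_baseNorm]
  change ((@Algebra.norm (E i ⊔ ltField π k : IntermediateField (v.adicCompletion K) (AlgebraicClosure (v.adicCompletion K)))
      (E (i + 1) ⊔ ltField π k : IntermediateField (v.adicCompletion K) (AlgebraicClosure (v.adicCompletion K))) _ _
      (towerAlgebra (sup_le_sup_right (hmono (Nat.le_succ i)) (ltField π k)))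
      ⟨absClosureEmbedding K (v.adicCompletion K) (x (i + 1) k),
        absClosureEmbedding_mem_sup_ltField_of_mem_rayClassField_mul_pow (h𝔪0 (i + 1)) (hv (i + 1)) hπ (hα0 (i + 1))
          (hα𝔪 (i + 1)) (hαw (i + 1)) (hαπ (i + 1)) (E (i + 1)) (hdegE (i + 1)) k (x (i + 1) k).2⟩ :
      (E i ⊔ ltField π k : IntermediateField (v.adicCompletion K) (AlgebraicClosure (v.adicCompletion K)))) :
      AlgebraicClosure (v.adicCompletion K)) = absClosureEmbedding K (v.adicCompletion K) (x i k)
  rw [← absClosureEmbedding_towerNorm_rayClassField_unramified_eq (h𝔪0 i) (h𝔪0 (i + 1)) (hanti i) (hv (i + 1)) hπ (hα0 i) (hα𝔪 i)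
    (hαw i) (hαπ i) (hα0 (i + 1)) (hα𝔪 (i + 1)) (hαw (i + 1)) (hαπ (i + 1)) (E i) (E (i + 1)) (hmono (Nat.le_succ i)) (hE (i + 1))
    (hdegE i) (hdegE (i + 1)) (hinert i) k (hcount i k) (x (i + 1) k), hcoh₂ i k]

include hanti hinert hcount hcoh₂ in
/-- ★ **`ofGlobal₂ x ∈ coherentFamilies`** (the submonoid of baseNorm-coherent families). [cite: deShalit1987, III.1.1–1.3 (p. 88–90)] -/
theorem ofGlobal₂_mem_coherentFamilies :
    (fun i => RelNormCoherentUnits.ofGlobal₂ hπ h𝔪0 hv hw hα0 hα𝔪 hαw hαπ E hE hdegE x hx0 hint hint' hcoh i) ∈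
      coherentFamilies hπ E hmono :=
  fun i => ofGlobal₂_baseNormCoherent hπ h𝔪0 hanti hv hw hα0 hα𝔪 hαw hαπ E hmono hE hdegE x hx0 hint hint' hcoh hinert hcount hcoh₂ i

/-! ### §2. The principal projection lands in `principalCoherentFamilies` -/

include hanti hinert hcount hcoh₂ in
/-- ★ **`⟨ofGlobal₂ x⟩ ∈ principalCoherentFamilies`**: the principal projection (levelwise Teichmüller decomposition) of the two-variable
family of global units is a principal coherent family — an element of `𝒰¹_∞`, the domain of the two-variable Coleman map `colemanImage`.
[cite: deShalit1987, Ch. I §3.8 (16)–(17); III.1.3 (p. 90)] [cite: SerreLocalFields1979, Ch. II §4 Prop. 8] -/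
theorem principalPart_ofGlobal₂_mem_principalCoherentFamilies [CharZero (v.adicCompletion K)] :
    (fun i => (RelNormCoherentUnits.ofGlobal₂ hπ h𝔪0 hv hw hα0 hα𝔪 hαw hαπ E hE hdegE x hx0 hint hint' hcoh i).principalPart) ∈
      principalCoherentFamilies hπ E hmono :=
  principalPart_mem_principalCoherentFamilies hπ E hmono
    (ofGlobal₂_baseNormCoherent hπ h𝔪0 hanti hv hw hα0 hα𝔪 hαw hαπ E hmono hE hdegE x hx0 hint hint' hcoh hinert hcount hcoh₂)

end OfGlobal₂

/-! ### §3. Re-indexing with an offset: `extendDown` -/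

section ExtendDown

variable {F : Type} [Field F] [ValuativeRel F] [TopologicalSpace F] [IsNonarchimedeanLocalField F]
  {π : 𝒪[F]} (hπ : (valuation F).IsUniformizer (π : F))
  (E : ℕ → IntermediateField F (AlgebraicClosure F)) [∀ m, FiniteDimensional F (E m)] [∀ m, IsGalois F (E m)] (hmono : Monotone E)
  (c : ℕ)

omit [ValuativeRel F] [TopologicalSpace F] [IsNonarchimedeanLocalField F] [∀ m, FiniteDimensional F (E m)] [∀ m, IsGalois F (E m)] in
include hmono in
/-- The shifted tower `i ↦ E_{i+c}` is monotone. [cite: deShalit1987, III.1.1 (p. 88)] -/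
theorem monotone_shift : Monotone fun i => E (i + c) := fun _ _ h => hmono (Nat.add_le_add_right h c)

/-- **`extendDown β`**: a family `β_i ∈ 𝒰(E_{i+c}·K_π^∞)` on the shifted tower, re-indexed to the whole tower `E_j` by norming down —
`(extendDown β)_j := N_{E_{(j−c)+c}/E_j} β_{j−c}` (for `j ≥ c` the norm is along `E_j = E_{(j−c)+c}`, i.e. `β_{j−c}` itself; for `j < c` it is
`N_{E_c/E_j} β_0`). [cite: deShalit1987, III.1.2 Lemma (ii) (p. 89)] -/
def extendDown (β : ∀ i, RelNormCoherentUnits hπ (E (i + c))) (j : ℕ) : RelNormCoherentUnits hπ (E j) :=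
  (β (j - c)).baseNorm hπ (hmono le_tsub_add)

/-- `(extendDown β)_j` (unfolding). [cite: deShalit1987, III.1.2 Lemma (ii) (p. 89)] -/
theorem extendDown_apply (β : ∀ i, RelNormCoherentUnits hπ (E (i + c))) (j : ℕ) :
    extendDown hπ E hmono c β j = (β (j - c)).baseNorm hπ (hmono le_tsub_add) := rfl

/-- Index transport: `N_{E_{a+c}/E_j} β_a = N_{E_{b+c}/E_j} β_b` for `a = b`. [folklore] -/
private theorem baseNorm_congr_index (β : ∀ i, RelNormCoherentUnits hπ (E (i + c))) {a b : ℕ} (e : a = b) {j : ℕ}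
    (ha : E j ≤ E (a + c)) (hb : E j ≤ E (b + c)) : (β a).baseNorm hπ ha = (β b).baseNorm hπ hb := by
  subst e; rfl

/-- ★ **`extendDown β` is baseNorm-coherent** when `β` is (along the shifted tower). [cite: deShalit1987, III.1.2 Lemma (ii), III.1.3 (p. 89–90)] -/
theorem extendDown_mem_coherentFamilies {β : ∀ i, RelNormCoherentUnits hπ (E (i + c))}
    (hβ : ∀ i, (β (i + 1)).baseNorm hπ (monotone_shift E hmono c (Nat.le_succ i)) = β i) :
    extendDown hπ E hmono c β ∈ coherentFamilies hπ E hmono := by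
  intro j
  rw [extendDown_apply, extendDown_apply, RelNormCoherentUnits.baseNorm_baseNorm]
  by_cases hcj : c ≤ j
  · -- `j + 1 - c = (j - c) + 1`: one step of `β`'s coherence, then transitivity
    have e : j + 1 - c = (j - c) + 1 := by omega
    rw [baseNorm_congr_index hπ E c β e _ ((hmono (le_tsub_add : j ≤ j - c + c)).trans
      (monotone_shift E hmono c (Nat.le_succ (j - c)))), ← RelNormCoherentUnits.baseNorm_baseNorm hπ (hmono le_tsub_add)
      (monotone_shift E hmono c (Nat.le_succ (j - c))), hβ (j - c)]
  · -- below the offset both sides are `N_{E_c/E_j} β_0`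
    have e1 : j + 1 - c = 0 := by omega
    have e2 : j - c = 0 := by omega
    rw [baseNorm_congr_index hπ E c β e1 _ (hmono (by omega)), baseNorm_congr_index hπ E c β e2 _ (hmono (by omega))]

/-- `N_{E/E} β = β` (the norm along the identity). [cite: deShalit1987, III.1.2 Lemma (ii) (p. 89)] -/
theorem _root_.Literature.NumberTheory.GaloisRepresentations.RelNormCoherentUnits.baseNorm_refl
    {E₀ : IntermediateField F (AlgebraicClosure F)} [FiniteDimensional F E₀] [IsGalois F E₀] (β : RelNormCoherentUnits hπ E₀) :
    β.baseNorm hπ (le_refl E₀) = β := by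
  refine RelNormCoherentUnits.ext fun m => Subtype.ext ?_
  rw [RelNormCoherentUnits.coe_val_baseNorm]
  have hinst : (towerAlgebra (F := F) (sup_le_sup_right (le_refl E₀) (ltField π m) :
      (E₀ ⊔ ltField π m : IntermediateField F (AlgebraicClosure F)) ≤ E₀ ⊔ ltField π m)) =
      Algebra.id (E₀ ⊔ ltField π m : IntermediateField F (AlgebraicClosure F)) :=
    Algebra.algebra_ext _ _ fun y => Subtype.ext rfl
  rw [hinst, Algebra.norm_self, MonoidHom.id_apply]

/-- **On the shifted levels `extendDown β` is `β`**: `(extendDown β)_{i+c} = β_i`. [cite: deShalit1987, III.1.3 (p. 90)] -/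
theorem extendDown_add (β : ∀ i, RelNormCoherentUnits hπ (E (i + c))) (i : ℕ) : extendDown hπ E hmono c β (i + c) = β i := by
  rw [extendDown_apply, baseNorm_congr_index hπ E c β (Nat.add_sub_cancel i c) _ (le_refl _),
    RelNormCoherentUnits.baseNorm_refl]

/-- `extendDown` is multiplicative (termwise products). [cite: deShalit1987, III.1.2 Lemma (ii) (p. 89)] -/
theorem extendDown_mul (β β' : ∀ i, RelNormCoherentUnits hπ (E (i + c))) (j : ℕ) :
    extendDown hπ E hmono c (fun i => (β i).mul (β' i)) j = (extendDown hπ E hmono c β j).mul (extendDown hπ E hmono c β' j) := by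
  rw [extendDown_apply, extendDown_apply, extendDown_apply, RelNormCoherentUnits.baseNorm_mul]

/-- `extendDown` commutes with the Galois action. [cite: deShalit1987, Ch. I §3.8 (16)] -/
theorem extendDown_galAct (σ : absoluteGaloisGroup F) (β : ∀ i, RelNormCoherentUnits hπ (E (i + c))) (j : ℕ) :
    extendDown hπ E hmono c (fun i => (β i).galAct σ) j = (extendDown hπ E hmono c β j).galAct σ := by
  rw [extendDown_apply, extendDown_apply, RelNormCoherentUnits.baseNorm_galAct]

/-- `extendDown` commutes with the principal projection. [cite: SerreLocalFields1979, Ch. II §4 Prop. 8] -/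
theorem extendDown_principalPart [CharZero F] (β : ∀ i, RelNormCoherentUnits hπ (E (i + c))) (j : ℕ) :
    extendDown hπ E hmono c (fun i => (β i).principalPart) j = (extendDown hπ E hmono c β j).principalPart := by
  rw [extendDown_apply, extendDown_apply, RelNormCoherentUnits.principalPart_baseNorm]

/-- ★ **`extendDown ⟨β⟩ ∈ principalCoherentFamilies`** for a coherent family `β` on the shifted tower. [cite: deShalit1987, Ch. I §3.8 (16)–(17); III.1.3] -/
theorem extendDown_principalPart_mem_principalCoherentFamilies [CharZero F] {β : ∀ i, RelNormCoherentUnits hπ (E (i + c))}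
    (hβ : ∀ i, (β (i + 1)).baseNorm hπ (monotone_shift E hmono c (Nat.le_succ i)) = β i) :
    extendDown hπ E hmono c (fun i => (β i).principalPart) ∈ principalCoherentFamilies hπ E hmono := by
  have h : extendDown hπ E hmono c (fun i => (β i).principalPart) = fun j => (extendDown hπ E hmono c β j).principalPart :=
    funext fun j => extendDown_principalPart hπ E hmono c β j
  rw [h]
  exact principalPart_mem_principalCoherentFamilies hπ E hmono (extendDown_mem_coherentFamilies hπ E hmono c hβ)

end ExtendDown

end Literature.NumberTheory.EllipticCurves

end
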